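import Summits.BirchSwinnertonDyer.BirchSwinnertonDyer.Theorems.GoldfeldAllTwistsTwoConverseTwinAdditiveTwoPrimesTwistSelmerCount
import Summits.BirchSwinnertonDyer.BirchSwinnertonDyer.Theorems.GoldfeldAllTwistsTwoConverseTwinAdditiveTwoPrimesTwistSelmerDual
import HarnessLib

set_option linter.dupNamespace false -- namespace `…BirchSwinnertonDyer.BirchSwinnertonDyer…` is the cell's (D-0017 nested layout)
set_option autoImplicit false

/-!
# Twin″ (item 19140), LINE B⁗ T3-D: the complete `2`-descent for `49a1^{(−2qp)}` on family C — `rank ≤ 1`, and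
# `Ш[2] = 0`, `Ш[2^∞] = 0`, `corank_{ℤ₂} Sel_{2^∞} = 1` in rank one

Cell `bsd-goldfeld`, seat `bsd-goldfeld-s1p-c3x` (gen 10); planner ORDER (cccxvii) «LINE B⁗ — TRANCHE 3», object T3-D (= N3), the
descent file (template XVI `…TwinAdditiveTwoInertSevenTwistDescent`). `--supports stmt-BirchSwinnertonDyer-19140` as a HELPER.
FACT-FREE (no fact binder, no definition, no `sorry`): the GZK-conditional `BSD(W,2) ⟺ #Ш_an odd` corollary of the templates is
deliberately NOT restated here (it is one call of `bsdp_two_iff_shaAn_unit_of_forall_mem_sha` away and belongs to the T3-I closer).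

Family C: primes `q ≡ 3 (mod 4)` with `(q/7) = −1` and `p ≡ 5 (mod 8)` with `(−7/p) = +1`, `(p/q) = −1`, and the cell condition
`hcell : q ≡ 7 (mod 8) ∨ ∃ x, x⁴ = −7 (mod p)` (= C4 ∪ C6 ∪ C8; on the excluded corner `q ≡ 3 (8) ∧ ¬β` the bound fails: `#S = 4`,
`#S′ = 8` numerically, memo `ROUTE-S1PLUS/b4-c3xg10/T3D-DESCENT-KILLTABLE.md`). From parts 2 and 3b (`#S(−42qp, 448q²p²) ≤ 2`,
`#S(84qp, −28q²p²) ≤ 4`): `#S·#S′ ≤ 8`, whence for every model `W` of `49a1^{(−2qp)}` (`C • W = cm7.quadraticTwist (−2qp)`):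
`rank W(ℚ) ≤ 1`, and `rank W(ℚ) = 1 ⇒ Ш(W)[2] = 0 ⇒ Ш(W)[2^∞] = 0 ∧ corank_{ℤ₂} Sel_{2^∞}(W) = 1` — UNCONDITIONALLY.
HONEST FRAMING: no `BSD(W,2)` is proved; BSD is not proved by any of this.

References: Silverman, *AEC* (2009), X.4.2(a), X.4.9 [SilvermanAEC2009].
-/

noncomputable section

open scoped Classical

open WeierstrassCurve Literature.NumberTheory.EllipticCurves

namespace Summit.BirchSwinnertonDyer.BirchSwinnertonDyer.Theorems.GoldfeldGoodTwists

section Descent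
variable {q p : ℕ} [Fact q.Prime] [Fact p.Prime]

/-- **`rank E_{−2qp}(ℚ) ≤ 1`, and `rank = 1 ⇒ Ш(E_{−2qp}/ℚ)[2] = 0`** (UNCONDITIONAL) for the two-torsion model
`E_{−2qp} : y² = x³ − 42qp·x² + 448q²p²·x` on family C with `hcell` (`#S · #S′ ≤ 2·4 = 8`). [cite: SilvermanAEC2009, Thm. X.4.2(a), Prop. X.4.9] -/
theorem rank_le_one_and_sha_two_twoTorsionModel_twoPrimesTwist (hq4 : q % 4 = 3) (hq7 : jacobiSym q 7 = -1) (hp8 : p % 8 = 5)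
    (hp7 : legendreSym p (-7) = 1) (hpq : jacobiSym p q = -1) (hcell : q % 8 = 7 ∨ ∃ x : ZMod p, x ^ 4 = -7)
    [hE : (⟨0, ((-42 * ((q : ℤ) * p) : ℤ) : ℚ), 0, ((448 * ((q : ℤ) * p) ^ 2 : ℤ) : ℚ), 0⟩ : WeierstrassCurve ℚ).IsElliptic] :
    (⟨0, ((-42 * ((q : ℤ) * p) : ℤ) : ℚ), 0, ((448 * ((q : ℤ) * p) ^ 2 : ℤ) : ℚ), 0⟩ : WeierstrassCurve ℚ).mordellWeilRank ≤ 1 ∧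
      ((⟨0, ((-42 * ((q : ℤ) * p) : ℤ) : ℚ), 0, ((448 * ((q : ℤ) * p) ^ 2 : ℤ) : ℚ), 0⟩ : WeierstrassCurve ℚ).mordellWeilRank = 1 →
        ∀ c ∈ (⟨0, ((-42 * ((q : ℤ) * p) : ℤ) : ℚ), 0, ((448 * ((q : ℤ) * p) ^ 2 : ℤ) : ℚ), 0⟩ : WeierstrassCurve ℚ).sha,
          2 • c = 0 → c = 0) := by
  have hq : q.Prime := Fact.out
  have hp : p.Prime := Fact.out
  have hab := hab_inertTwoTwist (m := q * p) (Nat.mul_pos hq.pos hp.pos)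
  push_cast at hab
  haveI := isElliptic_halfModel hab
  have hS := card_twoIsogenySelmerGroup_twoPrimesTwist_le hq4 hq7 hp8 hp7 hpq hcell
  have hS' := card_twoIsogenySelmerGroup'_twoPrimesTwist_le hq4 hq7 hp8 hp7 hpq hcell
  obtain ⟨hr, hparts⟩ := rank_le_one_and_sha_parts_of_card_mul_le hab
    (by nlinarith [hS, hS', Nat.zero_le (twoIsogenySelmerGroup (-42 * ((q : ℤ) * p)) (448 * ((q : ℤ) * p) ^ 2)).card])
  refine ⟨hr, fun h => ?_⟩
  obtain ⟨h₀, h₁⟩ := hparts h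
  exact forall_mem_sha_two_smul_eq_zero_of_halfModel h₀ h₁

/-- **UNCONDITIONAL: `rank W(ℚ) ≤ 1`, and `rank W(ℚ) = 1 ⇒ Ш(W/ℚ)[2] = 0`, for every model `W` of `49a1^{(−2qp)}`** on family C
with `hcell`. [cite: SilvermanAEC2009, Thm. X.4.2(a), Prop. X.4.9, Thm. III.6.2(a)] -/
theorem rank_le_one_and_sha_two_twoPrimesTwist (hq4 : q % 4 = 3) (hq7 : jacobiSym q 7 = -1) (hp8 : p % 8 = 5)
    (hp7 : legendreSym p (-7) = 1) (hpq : jacobiSym p q = -1) (hcell : q % 8 = 7 ∨ ∃ x : ZMod p, x ^ 4 = -7)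
    (W : WeierstrassCurve ℚ) [W.IsElliptic] (C : VariableChange ℚ)
    (hC : C • W = cm7.quadraticTwist ((-2 * ((q : ℤ) * p) : ℤ) : ℚ)) :
    W.mordellWeilRank ≤ 1 ∧ (W.mordellWeilRank = 1 → ∀ c ∈ W.sha, 2 • c = 0 → c = 0) := by
  have hq : q.Prime := Fact.out
  have hp : p.Prime := Fact.out
  have hab := hab_inertTwoTwist (m := q * p) (Nat.mul_pos hq.pos hp.pos)
  push_cast at hab
  haveI := isElliptic_mk_of_ne_zero (F := ℚ) hab
  have hE := (smul_eq_twoTorsionModel_of_smul_eq_quadraticTwist (-2 * ((q : ℤ) * p)) W C hC).trans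
    (show (⟨0, ((21 * (-2 * ((q : ℤ) * p)) : ℤ) : ℚ), 0, ((112 * (-2 * ((q : ℤ) * p)) ^ 2 : ℤ) : ℚ), 0⟩ :
        WeierstrassCurve ℚ) = ⟨0, ((-42 * ((q : ℤ) * p) : ℤ) : ℚ), 0, ((448 * ((q : ℤ) * p) ^ 2 : ℤ) : ℚ), 0⟩ by
      ext <;> push_cast <;> ring)
  exact rank_le_one_and_sha_two_of_smul_eq W _ _ hE
    (rank_le_one_and_sha_two_twoTorsionModel_twoPrimesTwist hq4 hq7 hp8 hp7 hpq hcell)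

/-- **UNCONDITIONAL, in rank one: `Ш(W)[2^∞] = 0` and `corank_{ℤ₂} Sel_{2^∞}(W) = 1`** for every model `W` of `49a1^{(−2qp)}` on
family C with `hcell` and `rank W(ℚ) = 1` (from `Ш(W)[2] = 0`). [cite: SilvermanAEC2009, Thm. X.4.2(a), Prop. X.4.9] -/
theorem sha_two_primary_eq_bot_twoPrimesTwist (hq4 : q % 4 = 3) (hq7 : jacobiSym q 7 = -1) (hp8 : p % 8 = 5)
    (hp7 : legendreSym p (-7) = 1) (hpq : jacobiSym p q = -1) (hcell : q % 8 = 7 ∨ ∃ x : ZMod p, x ^ 4 = -7)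
    (W : WeierstrassCurve ℚ) [W.IsElliptic] (C : VariableChange ℚ)
    (hC : C • W = cm7.quadraticTwist ((-2 * ((q : ℤ) * p) : ℤ) : ℚ)) (hr : W.mordellWeilRank = 1) :
    (∀ c ∈ W.sha, 2 • c = 0 → c = 0) ∧ AddCommGroup.primaryComponent W.sha 2 = ⊥ ∧ W.selmerCorank 2 = 1 := by
  haveI : Fact (Nat.Prime 2) := ⟨Nat.prime_two⟩
  have h2 := (rank_le_one_and_sha_two_twoPrimesTwist hq4 hq7 hp8 hp7 hpq hcell W C hC).2 hr
  refine ⟨h2, W.primaryComponent_sha_eq_bot_of_forall h2, ?_⟩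
  rw [W.selmerCorank_eq_mordellWeilRank_add_holds 2, hr, W.shaCorank_eq_zero_of_forall 2 h2]

end Descent

end Summit.BirchSwinnertonDyer.BirchSwinnertonDyer.Theorems.GoldfeldGoodTwists

end
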